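import Literature.Analysis.FluidPDE.HardSphereFlowGroup
import Literature.Analysis.FluidPDE.HardSphereWindowCount
import HarnessLib

/-!
# `LambertianContactSwap.CollisionMomentBound` (stmt-AtomisticToContinuum-12102): the bridge from the
# item's collision sum over Alexander's construction to the trajectory collision sum

Helper file (`--supports stmt-AtomisticToContinuum-12102`).  The support item `CollisionMomentBound` of
route `LambertianContactSwap` writes its `|g|³`-weighted collision count with the explicit functionals of
the collision-by-collision construction of the hard-sphere flow
(`Literature.Analysis.FluidPDE.HardSphereFlowConstruction`): collisions are enumerated as
`m < Alexander.collisionCount z t`, the `m`-th one being read on the PRE-collisional exit configuration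
`y_m = S_{τ(z_m)} z_m` (`z_m = Alexander.stateAfter z m`) through the selector
`hit y i j = (i < j ∧ y ∈ contactSet i j ∧ IsIncoming y i j)`.  The collision-flux machinery of the tree
(`Literature.MathematicalPhysics.KineticTheory.CollisionFluxUpperBound`) is written instead for the
collision sum `∑ᶠ s ∈ collisionTimes γ ∩ [0, τ], Σ_{i ≠ j at contact in γ s} F(γ s, i, j)` of a
hard-sphere TRAJECTORY `γ` (right-continuous: `γ s` is post-collisional).  This file proves, pathwise and
for an arbitrary regular Hausdorff geometry, that the first is dominated by the second:

* `norm_reflectVel_fst_sub_snd`, `norm_vel_sub_vel_collidePair` — the elastic reflection preserves the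
  modulus of the relative velocity of the colliding pair (so velocity marks of `‖vᵢ − vⱼ‖` may be read
  before or after the collision);
* `sum_sum_ite_hit_eq` — on a simple incoming collision configuration with colliding pair `p` the
  `hit`-selected double sum has exactly one term, the one of `p` (`incomingPairs = {p}`);
* `ofReal_hitSum_le_collisionSum` — for a hard-sphere trajectory `γ` in a regular geometry, `0 ≤ t ≤ τ`,
  a real mark `f ≥ 0` read on pre-collisional configurations and an `ℝ≥0∞` mark `F` read on
  post-collisional ones with `f(y, p) ≤ F(collidePair p y, p)` at simple incoming `y`:
  `ofReal (Σ_{m < collisionCount (γ 0) t} Σ_{i,j} [hit y_m i j] f(y_m, i, j))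
     ≤ ∑ᶠ s ∈ collisionTimes γ ∩ [0, τ], Σ_{i ≠ j at contact} F(γ s, i, j)`
  (the instants `t_{m+1}`, `m < collisionCount`, are distinct collision times `≤ t` of `γ`, at which
  `γ = z_{m+1} = collidePair p y_m`, `IsHardSphereTrajectory.stateAfter_eq_apply`,
  `Alexander.FwdGood.exists_stateAfter_succ`);
* `ofReal_hitSum_le_collisionSum_flow` — the same along the orbit `s ↦ Φ_s z` of a good datum of any
  hard-sphere flow structure `Φ` (`Φ_0 z = z`).

With `f = 1 + ‖vᵢ − vⱼ‖³` this feeds the item's functional into the window/flux bound; the same bridge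
serves the `|g|²`-weighted sums of `ContactAngleEquidistribution` (same encoding).

References: C. Cercignani, R. Illner, M. Pulvirenti, *The Mathematical Theory of Dilute Gases* (1994),
§4.2, App. 4.A; I. Gallagher, L. Saint-Raymond, B. Texier, *From Newton to Boltzmann* (2013), §4.1.
-/

noncomputable section

open Set Function
open scoped ENNReal InnerProductSpace BigOperators Classical

namespace Summit.AtomisticToContinuum.HydrodynamicLimit.Theorems.LambertianContactSwapCollisionMomentBound

open Literature.Analysis.FluidPDE

/-! ### The elastic reflection preserves `‖vᵢ − vⱼ‖` -/

/-- The elastic reflection (unnormalised direction `n`, junk identity at `n = 0`) preserves the modulus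
of the relative velocity: `‖v' − w'‖ = ‖v − w‖`. [folklore] -/
theorem norm_reflectVel_fst_sub_snd {E : Type*} [NormedAddCommGroup E] [InnerProductSpace ℝ E]
    (n : E) (p : E × E) : ‖(reflectVel n p).1 - (reflectVel n p).2‖ = ‖p.1 - p.2‖ := by
  by_cases hn : n = 0
  · subst hn; simp
  set c : ℝ := ⟪p.1 - p.2, n⟫_ℝ / ‖n‖ ^ 2 with hc
  have hn2 : ‖n‖ ^ 2 ≠ 0 := pow_ne_zero 2 (norm_ne_zero_iff.2 hn)
  have hcn : c * ‖n‖ ^ 2 = ⟪p.1 - p.2, n⟫_ℝ := by rw [hc, div_mul_cancel₀ _ hn2]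
  have hdiff : (reflectVel n p).1 - (reflectVel n p).2 = (p.1 - p.2) - (2 * c) • n := by
    simp only [reflectVel, ← hc, mul_smul, two_smul]
    abel
  rw [← sq_eq_sq₀ (norm_nonneg _) (norm_nonneg _), hdiff, norm_sub_sq_real, inner_smul_right, ← hcn,
    norm_smul, mul_pow, Real.norm_eq_abs, sq_abs]
  ring

/-- A binary elastic collision preserves the modulus of the relative velocity of the colliding pair:
`‖vᵢ' − vⱼ'‖ = ‖vᵢ − vⱼ‖`. [folklore] -/
theorem norm_vel_sub_vel_collidePair {d : Type*} [Fintype d] {X : Type*} {N : ℕ} (G : Geometry d X)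
    {i j : Fin N} (hij : i ≠ j) (y : Config N d X) :
    ‖(collidePair G i j y i).2 - (collidePair G i j y j).2‖ = ‖(y i).2 - (y j).2‖ := by
  rw [collidePair_apply_left hij, collidePair_apply_right]
  exact norm_reflectVel_fst_sub_snd _ _

/-! ### The `hit` selector on a simple incoming collision configuration -/

variable {d : Type*} [Fintype d] {X : Type*} {N : ℕ} {G : Geometry d X} {ε : ℝ}

/-- On a simple incoming collision configuration `y` with colliding pair `p = (i₀, j₀)`, `i₀ < j₀`, the
selector `i < j ∧ y ∈ contactSet i j ∧ IsIncoming y i j` holds exactly for `(i, j) = p`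
(`Alexander.IsSimpleIncomingWith.incomingPairs_eq`), so the selected double sum is the single term
`f y i₀ j₀`. [folklore] -/
theorem sum_sum_ite_hit_eq {M : Type*} [AddCommMonoid M] {y : Config N d X} {p : Fin N × Fin N}
    (hp : Alexander.IsSimpleIncomingWith G ε y p) (f : Config N d X → Fin N → Fin N → M) :
    (∑ i : Fin N, ∑ j : Fin N,
      (if i < j ∧ y ∈ contactSet G N ε i j ∧ IsIncoming G y i j then f y i j else 0)) =
      f y p.1 p.2 := by
  classical
  have hiff : ∀ i j : Fin N,
      (i < j ∧ y ∈ contactSet G N ε i j ∧ IsIncoming G y i j) ↔ i = p.1 ∧ j = p.2 := by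
    intro i j
    have h : (i, j) ∈ Alexander.incomingPairs G ε y ↔ (i, j) ∈ ({p} : Set (Fin N × Fin N)) := by
      rw [hp.incomingPairs_eq]
    rw [Alexander.mem_incomingPairs, mem_singleton_iff, Prod.ext_iff] at h
    exact h
  simp_rw [hiff]
  rw [Finset.sum_eq_single_of_mem p.1 (Finset.mem_univ _)]
  · rw [Finset.sum_eq_single_of_mem p.2 (Finset.mem_univ _)]
    · simp
    · intro j _ hj
      rw [if_neg]
      exact fun h => hj h.2
  · intro i _ hi
    refine Finset.sum_eq_zero fun j _ => ?_
    rw [if_neg]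
    exact fun h => hi h.1

/-! ### The bridge: the item's collision sum is dominated by the trajectory collision sum -/

section Trajectory

variable [TopologicalSpace X] [T2Space X]

/-- **The `hit`-sum over Alexander's construction is dominated by the trajectory collision sum.**
Let `γ` be a hard-sphere trajectory in a regular Hausdorff geometry, `0 ≤ t ≤ τ`, `f ≥ 0` a real mark
read on PRE-collisional configurations and `F` an `ℝ≥0∞` mark read on POST-collisional ones, with
`ofReal (f y i₀ j₀) ≤ F (collidePair i₀ j₀ y) i₀ j₀` whenever `y` is a simple incoming collision
configuration with colliding pair `(i₀, j₀)`.  Then, with `z = γ 0`, `z_m = stateAfter z m` and the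
pre-collisional exit configurations `y_m = S_{τ(z_m)} z_m`,
`ofReal (Σ_{m < collisionCount z t} Σ_{i,j} [i < j, y_m ∈ contactSet i j, incoming] f(y_m, i, j))
  ≤ ∑ᶠ s ∈ collisionTimes γ ∩ [0, τ], Σ_{i ≠ j, ‖xᵢ(s) − xⱼ(s)‖ = ε} F(γ s, i, j)`:
for `m < collisionCount z t` the instant `t_{m+1} ≤ t` is finite, the `t_{m+1}` are distinct collision
times of `γ` with `γ(t_{m+1}) = z_{m+1} = collidePair i₀ j₀ y_m` for the unique incoming contact pair
`(i₀, j₀)` of `y_m`, which is still at contact in `γ(t_{m+1})`. [folklore] -/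
theorem ofReal_hitSum_le_collisionSum (hG : G.IsHardSphereRegular ε) {γ : ℝ → Config N d X}
    (hγ : IsHardSphereTrajectory G ε N γ) {t τ : ℝ} (ht : 0 ≤ t) (htτ : t ≤ τ)
    (f : Config N d X → Fin N → Fin N → ℝ) (hf : ∀ y i j, 0 ≤ f y i j)
    (F : Config N d X → Fin N → Fin N → ℝ≥0∞)
    (hfF : ∀ (y : Config N d X) (p : Fin N × Fin N), Alexander.IsSimpleIncomingWith G ε y p →
      ENNReal.ofReal (f y p.1 p.2) ≤ F (collidePair G p.1 p.2 y) p.1 p.2) :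
    ENNReal.ofReal (∑ m ∈ Finset.range (Alexander.collisionCount G ε (γ 0) t),
        ∑ i : Fin N, ∑ j : Fin N,
          (if i < j ∧
              freeFlight G (Alexander.freeExitTime G ε (Alexander.stateAfter G ε (γ 0) m)).toReal
                  (Alexander.stateAfter G ε (γ 0) m) ∈ contactSet G N ε i j ∧
              IsIncoming G (freeFlight G (Alexander.freeExitTime G ε
                  (Alexander.stateAfter G ε (γ 0) m)).toReal (Alexander.stateAfter G ε (γ 0) m)) i j
            then f (freeFlight G (Alexander.freeExitTime G ε
                  (Alexander.stateAfter G ε (γ 0) m)).toReal (Alexander.stateAfter G ε (γ 0) m)) i j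
            else 0)) ≤
      ∑ᶠ s ∈ collisionTimes G ε γ ∩ Icc 0 τ, ∑ i : Fin N, ∑ j : Fin N,
        (if i ≠ j ∧ ‖G.sepVec (γ s i).1 (γ s j).1‖ = ε then F (γ s) i j else 0) := by
  classical
  -- abbreviations: the count `K`, the exit configurations `Y m`, the instants `sm m = t_{m+1}`
  set K := Alexander.collisionCount G ε (γ 0) t with hKdef
  set Y : ℕ → Config N d X := fun m =>
    freeFlight G (Alexander.freeExitTime G ε (Alexander.stateAfter G ε (γ 0) m)).toReal
      (Alexander.stateAfter G ε (γ 0) m) with hYdef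
  have hYm : ∀ m, freeFlight G (Alexander.freeExitTime G ε (Alexander.stateAfter G ε (γ 0) m)).toReal
      (Alexander.stateAfter G ε (γ 0) m) = Y m := fun m => rfl
  simp only [hYm]
  set sm : ℕ → ℝ := fun m => (Alexander.collisionInstant G ε (γ 0) (m + 1)).toReal with hsmdef
  set Inner : ℝ → ℝ≥0∞ := fun s => ∑ i : Fin N, ∑ j : Fin N,
    (if i ≠ j ∧ ‖G.sepVec (γ s i).1 (γ s j).1‖ = ε then F (γ s) i j else 0) with hInnerdef
  have hfinT := hγ.locFinite 0 τ
  rw [finsum_mem_eq_finite_toFinset_sum _ hfinT]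
  change _ ≤ ∑ s ∈ hfinT.toFinset, Inner s
  -- the forward orbit of `γ 0` is forward-good; instants `t_{m+1}`, `m < K`, are finite and `≤ t`
  have hfwd : Alexander.FwdGood G ε (γ 0) := hγ.fwdGood_apply_zero hG
  have hle : ∀ m, m < K → Alexander.collisionInstant G ε (γ 0) (m + 1) ≤ ENNReal.ofReal t :=
    fun m hm => (Alexander.le_collisionCount_iff hfwd).1 (Nat.succ_le_of_lt hm)
  have hfin : ∀ m, m < K → Alexander.collisionInstant G ε (γ 0) (m + 1) ≠ ∞ :=
    fun m hm => ne_top_of_le_ne_top ENNReal.ofReal_ne_top (hle m hm)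
  have hst : ∀ m, m < K →
      Alexander.stateAfter G ε (γ 0) (m + 1) = γ (sm m) ∧ sm m ∈ collisionTimes G ε γ :=
    fun m hm => ⟨(hγ.stateAfter_eq_apply hG (hfin m hm)).1,
      (hγ.stateAfter_eq_apply hG (hfin m hm)).2 (Nat.succ_pos m)⟩
  have hmemT : ∀ m, m < K → sm m ∈ hfinT.toFinset := by
    intro m hm
    rw [Set.Finite.mem_toFinset]
    exact ⟨(hst m hm).2, ENNReal.toReal_nonneg, (ENNReal.toReal_le_of_le_ofReal ht (hle m hm)).trans htτ⟩
  have hτfin : ∀ m, m < K →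
      Alexander.freeExitTime G ε (Alexander.stateAfter G ε (γ 0) m) ≠ ∞ := by
    intro m hm
    have h := hfin m hm
    rw [Alexander.collisionInstant_succ, ENNReal.add_ne_top] at h
    exact h.2
  -- the instants are distinct
  have hlt_of_lt : ∀ m₁ m₂, m₂ < K → m₁ < m₂ → sm m₁ < sm m₂ := by
    intro m₁ m₂ hm₂ h12
    have hmono : Alexander.collisionInstant G ε (γ 0) (m₁ + 1 + 1) ≤
        Alexander.collisionInstant G ε (γ 0) (m₂ + 1) :=
      Alexander.monotone_collisionInstant _ (by omega)
    have hfin₁ : Alexander.collisionInstant G ε (γ 0) (m₁ + 1) ≠ ∞ :=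
      ne_top_of_le_ne_top (hfin m₂ hm₂)
        ((Alexander.monotone_collisionInstant _ (Nat.le_succ _)).trans hmono)
    have hlt : Alexander.collisionInstant G ε (γ 0) (m₁ + 1) <
        Alexander.collisionInstant G ε (γ 0) (m₂ + 1) :=
      (hfwd.collisionInstant_lt_succ hG (Nat.succ_pos m₁) hfin₁).trans_le hmono
    exact (ENNReal.toReal_lt_toReal hfin₁ (hfin m₂ hm₂)).2 hlt
  have hinj : ∀ m₁ ∈ Finset.range K, ∀ m₂ ∈ Finset.range K, sm m₁ = sm m₂ → m₁ = m₂ := by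
    intro m₁ hm₁ m₂ hm₂ heq
    rw [Finset.mem_range] at hm₁ hm₂
    rcases lt_trichotomy m₁ m₂ with h | h | h
    · exact absurd heq (hlt_of_lt m₁ m₂ hm₂ h).ne
    · exact h
    · exact absurd heq (hlt_of_lt m₂ m₁ hm₁ h).ne'
  -- the pointwise comparison at the `m`-th collision
  have hkey : ∀ m, m < K →
      ENNReal.ofReal (∑ i : Fin N, ∑ j : Fin N,
        (if i < j ∧ Y m ∈ contactSet G N ε i j ∧ IsIncoming G (Y m) i j then f (Y m) i j else 0)) ≤
      Inner (sm m) := by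
    intro m hm
    obtain ⟨p, hp, heq⟩ := hfwd.exists_stateAfter_succ (hτfin m hm)
    have hp' : Alexander.IsSimpleIncomingWith G ε (Y m) p := hp
    have heq' : γ (sm m) = collidePair G p.1 p.2 (Y m) := by rw [← (hst m hm).1]; exact heq
    rw [sum_sum_ite_hit_eq hp' f]
    have hcontact : ‖G.sepVec (γ (sm m) p.1).1 (γ (sm m) p.2).1‖ = ε := by
      rw [heq', collidePair_apply_fst, collidePair_apply_fst]
      exact hp'.mem_contactSet.2
    set g : Fin N → Fin N → ℝ≥0∞ := fun i j =>
      (if i ≠ j ∧ ‖G.sepVec (γ (sm m) i).1 (γ (sm m) j).1‖ = ε then F (γ (sm m)) i j else 0) with hg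
    have hgp : g p.1 p.2 = F (γ (sm m)) p.1 p.2 := by
      rw [hg]
      exact if_pos ⟨hp'.ne, hcontact⟩
    calc ENNReal.ofReal (f (Y m) p.1 p.2)
        ≤ F (collidePair G p.1 p.2 (Y m)) p.1 p.2 := hfF _ _ hp'
      _ = g p.1 p.2 := by rw [hgp, heq']
      _ ≤ ∑ j : Fin N, g p.1 j :=
          Finset.single_le_sum (f := fun j => g p.1 j) (fun _ _ => zero_le) (Finset.mem_univ p.2)
      _ ≤ ∑ i : Fin N, ∑ j : Fin N, g i j :=
          Finset.single_le_sum (f := fun i => ∑ j : Fin N, g i j) (fun _ _ => zero_le)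
            (Finset.mem_univ p.1)
      _ = Inner (sm m) := by rw [hInnerdef, hg]
  -- nonnegativity of the real summands
  have hnonneg : ∀ m, 0 ≤ ∑ i : Fin N, ∑ j : Fin N,
      (if i < j ∧ Y m ∈ contactSet G N ε i j ∧ IsIncoming G (Y m) i j then f (Y m) i j else 0) :=
    fun m => Finset.sum_nonneg fun i _ => Finset.sum_nonneg fun j _ => by
      split_ifs
      · exact hf _ _ _
      · exact le_rfl
  -- summation
  calc ENNReal.ofReal (∑ m ∈ Finset.range K, ∑ i : Fin N, ∑ j : Fin N,
          (if i < j ∧ Y m ∈ contactSet G N ε i j ∧ IsIncoming G (Y m) i j then f (Y m) i j else 0))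
      = ∑ m ∈ Finset.range K, ENNReal.ofReal (∑ i : Fin N, ∑ j : Fin N,
          (if i < j ∧ Y m ∈ contactSet G N ε i j ∧ IsIncoming G (Y m) i j then f (Y m) i j else 0)) :=
        ENNReal.ofReal_sum_of_nonneg fun m _ => hnonneg m
    _ ≤ ∑ m ∈ Finset.range K, Inner (sm m) :=
        Finset.sum_le_sum fun m hm => hkey m (Finset.mem_range.1 hm)
    _ = ∑ s ∈ (Finset.range K).image sm, Inner s := (Finset.sum_image hinj).symm
    _ ≤ ∑ s ∈ hfinT.toFinset, Inner s := by
        refine Finset.sum_le_sum_of_subset fun s hs => ?_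
        obtain ⟨m, hm, rfl⟩ := Finset.mem_image.1 hs
        exact hmemT m (Finset.mem_range.1 hm)

end Trajectory

section Flow

variable [MeasureTheory.MeasureSpace X] [TopologicalSpace X] [T2Space X]

/-- **The same bridge along a hard-sphere flow.** For any hard-sphere flow structure `Φ` in a regular
Hausdorff geometry and a good datum `z` (so `s ↦ Φ_s z` is a hard-sphere trajectory with `Φ_0 z = z`),
`0 ≤ t ≤ τ` and marks `f`, `F` as in `ofReal_hitSum_le_collisionSum`:
`ofReal (Σ_{m < collisionCount z t} Σ_{i,j} [hit y_m i j] f(y_m, i, j))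
  ≤ ∑ᶠ s ∈ collisionTimes (Φ· z) ∩ [0, τ], Σ_{i ≠ j at contact} F(Φ_s z, i, j)`. [folklore] -/
theorem ofReal_hitSum_le_collisionSum_flow (hG : G.IsHardSphereRegular ε) (Φ : HardSphereFlow G ε N)
    {z : Config N d X} (hz : z ∈ Φ.good) {t τ : ℝ} (ht : 0 ≤ t) (htτ : t ≤ τ)
    (f : Config N d X → Fin N → Fin N → ℝ) (hf : ∀ y i j, 0 ≤ f y i j)
    (F : Config N d X → Fin N → Fin N → ℝ≥0∞)
    (hfF : ∀ (y : Config N d X) (p : Fin N × Fin N), Alexander.IsSimpleIncomingWith G ε y p →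
      ENNReal.ofReal (f y p.1 p.2) ≤ F (collidePair G p.1 p.2 y) p.1 p.2) :
    ENNReal.ofReal (∑ m ∈ Finset.range (Alexander.collisionCount G ε z t),
        ∑ i : Fin N, ∑ j : Fin N,
          (if i < j ∧
              freeFlight G (Alexander.freeExitTime G ε (Alexander.stateAfter G ε z m)).toReal
                  (Alexander.stateAfter G ε z m) ∈ contactSet G N ε i j ∧
              IsIncoming G (freeFlight G (Alexander.freeExitTime G ε
                  (Alexander.stateAfter G ε z m)).toReal (Alexander.stateAfter G ε z m)) i j
            then f (freeFlight G (Alexander.freeExitTime G ε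
                  (Alexander.stateAfter G ε z m)).toReal (Alexander.stateAfter G ε z m)) i j
            else 0)) ≤
      ∑ᶠ s ∈ collisionTimes G ε (fun s => Φ.flow s z) ∩ Icc 0 τ, ∑ i : Fin N, ∑ j : Fin N,
        (if i ≠ j ∧ ‖G.sepVec (Φ.flow s z i).1 (Φ.flow s z j).1‖ = ε then F (Φ.flow s z) i j
          else 0) := by
  have hγ : IsHardSphereTrajectory G ε N fun s => Φ.flow s z := Φ.isTrajectory z hz
  have h0 : Φ.flow 0 z = z := Φ.flow_zero z hz
  have h := ofReal_hitSum_le_collisionSum hG hγ ht htτ f hf F hfF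
  beta_reduce at h
  rw [h0] at h
  exact h

end Flow

end Summit.AtomisticToContinuum.HydrodynamicLimit.Theorems.LambertianContactSwapCollisionMomentBound

end
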